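import Summits.QuantumFields.QCD.Theorems.GaussianLinkFramesFrameFMClosurePlacementSidesAux7

/-!
# Crux `GaussianLinkFrames.FrameFMClosure` (stmt-QuantumFields-17375), line `pad-the-fibre`, stub
`stub_placementSides` — helper 8: the pairing engine for antipodal configurations and the chart of the thinnest
box complement

* §1 `thin_compl_chart`: for `r = S - 1` a site lies outside `ebox S z r` iff one of its coordinates is the
  antipodal residue `q j = z j + S`.
* §2 `rs_engine`: given defect-triple bases `p` (each `q j` in its triple) and two blocks read in the chart of helper 7
  (interior = window ∨ trace per coordinate, windows far and flip-stable, traces on the triples), each block being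
  either TRACE-FREE in some coordinate (then it has no core site) or SAFE (one coordinate traces only the antipodal
  residue, and a common coordinate `k` traces a common domino `{v, v+1}`), the map "far flip if some coordinate is
  far, else swap `v ↔ v+1` in coordinate `k`" pairs each clipped block inside itself by involutive `±1`-moves — the
  `σ`-hypotheses of worker 1's `balanced_touched_of_blocks`.

References: elementary [folklore]; the pad recipe is the line card of `pad-the-fibre`.
-/

noncomputable section

open scoped BigOperators
open Literature.MathematicalPhysics.QuantumFieldTheory Literature.MathematicalPhysics.QuantumLattice
  Literature.Probability.LatticeModels
open Summit.QuantumFields.QCD.Theorems.VonMisesCircles Summit.QuantumFields.QCD.Theorems.PadTheFibre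

namespace Summit.QuantumFields.QCD.Theorems.PadTheFibreTwoStar

/-! ## §1 The thinnest box complement is the union of the antipodal hyperplanes -/

/-- **Chart of the thinnest box complement** (`1 ≤ S`): `y ∉ ebox S z (S - 1)` iff some coordinate of `y` is the
antipodal residue `z j + S`. [folklore] -/
theorem thin_compl_chart {S : ℕ} (hS : 1 ≤ S) (z y : TorusSite 4 (2 * S + 1)) :
    y ∉ ebox S z (S - 1) ↔ ∃ j, y j = z j + (S : ZMod (2 * S + 1)) := by
  haveI : NeZero (2 * S + 1) := ⟨by omega⟩
  haveI : Fact (1 < 2 * S + 1) := ⟨by omega⟩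
  rw [mem_ebox_iff_val z y (S - 1) (by omega)]
  -- `x.val ≤ N - 2` iff `x ≠ -1`
  have hm1 : ∀ x : ZMod (2 * S + 1), x.val ≤ 2 * S - 1 ↔ x ≠ -1 := by
    intro x
    constructor
    · rintro h rfl
      rw [ZMod.neg_val, if_neg one_ne_zero, ZMod.val_one] at h
      omega
    · intro h
      have hx : x.val < 2 * S + 1 := ZMod.val_lt _
      by_contra h'
      apply h
      have hv : x.val = 2 * S := by omega
      have h0 : x + 1 = 0 := by
        apply (ZMod.val_eq_zero _).1
        rw [ZMod.val_add, ZMod.val_one, hv, Nat.mod_self]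
      linear_combination h0
  have key : ∀ j, (y j - z j + ((S - 1 + 1 : ℕ) : ZMod (2 * S + 1))).val ≤ 2 * (S - 1) + 1 ↔
      y j ≠ z j + (S : ZMod (2 * S + 1)) := by
    intro j
    have e : y j - z j + ((S - 1 + 1 : ℕ) : ZMod (2 * S + 1)) = (y j - (z j + (S : ZMod (2 * S + 1)))) - 1 := by
      rw [show (S - 1 + 1 : ℕ) = S by omega]
      have : ((S : ℕ) : ZMod (2 * S + 1)) + (S : ZMod (2 * S + 1)) + 1 = 0 := by
        rw [show ((S : ℕ) : ZMod (2 * S + 1)) + (S : ZMod (2 * S + 1)) + 1 = ((2 * S + 1 : ℕ) : ZMod (2 * S + 1)) by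
          push_cast; ring]
        exact ZMod.natCast_self _
      linear_combination this
    rw [e, show 2 * (S - 1) + 1 = 2 * S - 1 by omega, hm1]
    constructor
    · intro h hq; apply h; rw [hq]; ring
    · intro h h1; apply h; linear_combination h1
  simp only [key, not_forall, not_not]

/-! ## §2 The pairing engine -/

/-- **The pairing engine for antipodal configurations** (`4 ≤ S`).  See the module docstring.  Conclusion: the four
`σ`-hypotheses of `balanced_touched_of_blocks` for the two clipped blocks `P₁ ∩ A`, `P₂ ∩ A`,
`A = {y | ∃ j, y j = q j}` read through membership `w ∉ E` in a set `E` with `w ∉ E ↔ ∃ j, w j = q j`. [folklore] -/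
theorem rs_engine {S : ℕ} (hS : 4 ≤ S) (E : Finset (TorusSite 4 (2 * S + 1))) (q p : Fin 4 → ZMod (2 * S + 1))
    (hE : ∀ w, w ∉ E ↔ ∃ j, w j = q j) (hq : ∀ i, 2 * S + 1 - 3 ≤ (q i - p i).val)
    (P₁ P₂ : Finset (TorusSite 4 (2 * S + 1))) (W₁ T₁ W₂ T₂ : Fin 4 → ZMod (2 * S + 1) → Prop)
    (hP₁ : ∀ y, y ∈ P₁ ↔ ∀ j, W₁ j (y j) ∨ T₁ j (y j)) (hP₂ : ∀ y, y ∈ P₂ ↔ ∀ j, W₂ j (y j) ∨ T₂ j (y j))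
    (hWf₁ : ∀ j u, W₁ j u → (u - p j).val ≤ 2 * S + 1 - 4) (hWf₂ : ∀ j u, W₂ j u → (u - p j).val ≤ 2 * S + 1 - 4)
    (hTc₁ : ∀ j u, T₁ j u → 2 * S + 1 - 3 ≤ (u - p j).val) (hTc₂ : ∀ j u, T₂ j u → 2 * S + 1 - 3 ≤ (u - p j).val)
    (hWπ₁ : ∀ j u, W₁ j u → W₁ j (if Even (u - p j).val then u + 1 else u - 1))
    (hWπ₂ : ∀ j u, W₂ j u → W₂ j (if Even (u - p j).val then u + 1 else u - 1))
    (i₁ i₂ k : Fin 4) (v : ZMod (2 * S + 1))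
    (hs₁ : (∃ j, ∀ u, ¬ T₁ j u) ∨ ((∀ u, T₁ i₁ u → u = q i₁) ∧ i₁ ≠ k ∧ ∀ u, T₁ k u ↔ (u = v ∨ u = v + 1)))
    (hs₂ : (∃ j, ∀ u, ¬ T₂ j u) ∨ ((∀ u, T₂ i₂ u → u = q i₂) ∧ i₂ ≠ k ∧ ∀ u, T₂ k u ↔ (u = v ∨ u = v + 1))) :
    ∃ σ : TorusSite 4 (2 * S + 1) → TorusSite 4 (2 * S + 1),
      (∀ w ∈ P₁, w ∉ E → σ w ∈ P₁ ∧ σ w ∉ E) ∧ (∀ w ∈ P₂, w ∉ E → σ w ∈ P₂ ∧ σ w ∉ E) ∧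
      (∀ w ∈ P₁ ∪ P₂, w ∉ E → σ (σ w) = w) ∧
      (∀ w ∈ P₁ ∪ P₂, w ∉ E → ∃ μ : Fin 4, σ w = w + Pi.single μ 1 ∨ w = σ w + Pi.single μ 1) := by
  haveI : NeZero (2 * S + 1) := ⟨by omega⟩
  haveI : Fact (1 < 2 * S + 1) := ⟨by omega⟩
  classical
  set π : Fin 4 → ZMod (2 * S + 1) → ZMod (2 * S + 1) := fun j u =>
    if Even (u - p j).val then u + 1 else u - 1 with hπ
  set σf : TorusSite 4 (2 * S + 1) → TorusSite 4 (2 * S + 1) := fun y =>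
      if (y 0 - p 0).val ≤ 2 * S + 1 - 4 then Function.update y 0 (π 0 (y 0)) else
      if (y 1 - p 1).val ≤ 2 * S + 1 - 4 then Function.update y 1 (π 1 (y 1)) else
      if (y 2 - p 2).val ≤ 2 * S + 1 - 4 then Function.update y 2 (π 2 (y 2)) else
      if (y 3 - p 3).val ≤ 2 * S + 1 - 4 then Function.update y 3 (π 3 (y 3)) else y with hσf
  have FAR : ∀ y : TorusSite 4 (2 * S + 1), (∃ j, (y j - p j).val ≤ 2 * S + 1 - 4) →
      σf (σf y) = y ∧ (∃ μ : Fin 4, σf y = y + Pi.single μ 1 ∨ y = σf y + Pi.single μ 1) ∧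
      (∃ j, (σf y j - p j).val ≤ 2 * S + 1 - 4) ∧
      (∀ I : Fin 4 → ZMod (2 * S + 1) → Prop, (∀ j u, I j u → (u - p j).val ≤ 2 * S + 1 - 4 → I j (π j u)) →
        (∀ j, I j (y j)) → ∀ j, I j (σf y j)) ∧
      (∀ q : Fin 4 → ZMod (2 * S + 1), (∀ i, 2 * S + 1 - 3 ≤ (q i - p i).val) → (∃ i, y i = q i) →
        ∃ i, σf y i = q i) :=
    tstar_far (N := 2 * S + 1) (by omega) ⟨S, by ring⟩ p
  set sw : ZMod (2 * S + 1) → ZMod (2 * S + 1) := fun u => if u = v then v + 1 else if u = v + 1 then v else u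
    with hsw
  set σ : TorusSite 4 (2 * S + 1) → TorusSite 4 (2 * S + 1) := fun y =>
    if ∃ j, (y j - p j).val ≤ 2 * S + 1 - 4 then σf y else Function.update y k (sw (y k)) with hσ
  have hv1 : v + 1 ≠ v := by
    intro h; have : (1 : ZMod (2 * S + 1)) = 0 := by linear_combination h
    exact one_ne_zero this
  have hsw_v : sw v = v + 1 := by simp [hsw]
  have hsw_v1 : sw (v + 1) = v := by simp [hsw, hv1]
  -- one block at a time
  have blk : ∀ (P : Finset (TorusSite 4 (2 * S + 1))) (W T : Fin 4 → ZMod (2 * S + 1) → Prop) (i : Fin 4),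
      (∀ y, y ∈ P ↔ ∀ j, W j (y j) ∨ T j (y j)) → (∀ j u, W j u → (u - p j).val ≤ 2 * S + 1 - 4) →
      (∀ j u, T j u → 2 * S + 1 - 3 ≤ (u - p j).val) → (∀ j u, W j u → W j (π j u)) →
      ((∃ j, ∀ u, ¬ T j u) ∨ ((∀ u, T i u → u = q i) ∧ i ≠ k ∧ ∀ u, T k u ↔ (u = v ∨ u = v + 1))) →
      ∀ w ∈ P, w ∉ E → σ w ∈ P ∧ σ w ∉ E ∧ σ (σ w) = w ∧
        ∃ μ : Fin 4, σ w = w + Pi.single μ 1 ∨ w = σ w + Pi.single μ 1 := by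
    intro P W T i hP hWf hTc hWπ hs w hw hwE
    have hwP := (hP w).1 hw
    by_cases hfar : ∃ j, (w j - p j).val ≤ 2 * S + 1 - 4
    · -- a far site: the far flip
      have hσw : σ w = σf w := by simp only [hσ]; rw [if_pos hfar]
      obtain ⟨hinv, hnn, hfar', hI, hA⟩ := FAR w hfar
      have hσw' : σ (σf w) = σf (σf w) := by simp only [hσ]; rw [if_pos hfar']
      refine ⟨?_, ?_, by rw [hσw, hσw', hinv], by rw [hσw]; exact hnn⟩
      · rw [hσw, hP]
        refine hI (fun j u => W j u ∨ T j u) (fun j u hu hfu => ?_) hwP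
        rcases hu with hu | hu
        · exact Or.inl (hWπ j u hu)
        · have := hTc j u hu; omega
      · rw [hσw, hE]; exact hA q hq ((hE w).1 hwE)
    · -- a core site: every coordinate traces
      have hT : ∀ j, T j (w j) := fun j => by
        rcases hwP j with h | h
        · exact (hfar ⟨j, hWf j _ h⟩).elim
        · exact h
      rcases hs with ⟨j, hj⟩ | ⟨hi, hik, hk⟩
      · exact (hj _ (hT j)).elim
      · have hwk : w k = v ∨ w k = v + 1 := (hk _).1 (hT k)
        have hσw : σ w = Function.update w k (sw (w k)) := by simp only [hσ]; rw [if_neg hfar]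
        have hswk : sw (w k) = v ∨ sw (w k) = v + 1 := by
          rcases hwk with h | h
          · rw [h, hsw_v]; right; rfl
          · rw [h, hsw_v1]; left; rfl
        have hTk : T k (sw (w k)) := (hk _).2 hswk
        have hfar2 : ¬ ∃ j, (σ w j - p j).val ≤ 2 * S + 1 - 4 := by
          rintro ⟨j, hj⟩
          by_cases hjk : j = k
          · subst hjk; rw [hσw, Function.update_self] at hj; have := hTc _ _ hTk; omega
          · rw [hσw, Function.update_of_ne hjk] at hj; have := hTc _ _ (hT j); omega
        refine ⟨?_, ?_, ?_, k, ?_⟩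
        · rw [hP]; intro j
          by_cases hjk : j = k
          · subst hjk; rw [hσw, Function.update_self]; exact Or.inr hTk
          · rw [hσw, Function.update_of_ne hjk]; exact Or.inr (hT j)
        · rw [hE]; refine ⟨i, ?_⟩
          rw [hσw, Function.update_of_ne hik]; exact hi _ (hT i)
        · have : σ (σ w) = Function.update (σ w) k (sw (σ w k)) := by simp only [hσ]; rw [if_neg hfar2]
          rw [this, hσw, Function.update_self, Function.update_idem]
          rcases hwk with h | h
          · rw [h, hsw_v, hsw_v1, ← h]; simp
          · rw [h, hsw_v1, hsw_v, ← h]; simp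
        · rcases hwk with h | h
          · left; rw [hσw, h, hsw_v]; ext j
            by_cases hjk : j = k
            · subst hjk; simp [h]
            · simp [hjk]
          · right; rw [hσw, h, hsw_v1]; ext j
            by_cases hjk : j = k
            · subst hjk; simp [h]
            · simp [hjk]
  refine ⟨σ, fun w hw hwE => ⟨(blk P₁ W₁ T₁ i₁ hP₁ hWf₁ hTc₁ hWπ₁ hs₁ w hw hwE).1,
    (blk P₁ W₁ T₁ i₁ hP₁ hWf₁ hTc₁ hWπ₁ hs₁ w hw hwE).2.1⟩, fun w hw hwE =>
    ⟨(blk P₂ W₂ T₂ i₂ hP₂ hWf₂ hTc₂ hWπ₂ hs₂ w hw hwE).1, (blk P₂ W₂ T₂ i₂ hP₂ hWf₂ hTc₂ hWπ₂ hs₂ w hw hwE).2.1⟩,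
    fun w hw hwE => ?_, fun w hw hwE => ?_⟩
  · rcases Finset.mem_union.1 hw with h | h
    · exact (blk P₁ W₁ T₁ i₁ hP₁ hWf₁ hTc₁ hWπ₁ hs₁ w h hwE).2.2.1
    · exact (blk P₂ W₂ T₂ i₂ hP₂ hWf₂ hTc₂ hWπ₂ hs₂ w h hwE).2.2.1
  · rcases Finset.mem_union.1 hw with h | h
    · exact (blk P₁ W₁ T₁ i₁ hP₁ hWf₁ hTc₁ hWπ₁ hs₁ w h hwE).2.2.2
    · exact (blk P₂ W₂ T₂ i₂ hP₂ hWf₂ hTc₂ hWπ₂ hs₂ w h hwE).2.2.2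

/-! ## §3 From two adapted blocks with strategies to a balanced placement -/

open Classical in
/-- **Balanced placement from two defect-triple blocks** (`4 ≤ S`, `r = S - 1`).  Given bases `p` with every
antipodal residue `q j = z j + S` in its triple, per-coordinate pad data for `a` and for `b` as produced by
`tstar_coord_data`, and for each point a strategy (a trace-free coordinate, or a coordinate tracing only the antipodal
residue together with the common domino `{v, v+1}` traced in the common coordinate `k`), the forced links of the two
blocks form canonical pad regions about pads holding `a`, `b` in their cores, and the touched region of
`star(a) ∪ star(b) ∪ Q₁ ∪ Q₂` in `(ebox S z (S-1))ᶜ` is bipartite-balanced. [folklore] -/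
theorem rs_blocks_balanced {S : ℕ} (hS : 4 ≤ S) (z : TorusSite 4 (2 * S + 1)) (p : Fin 4 → ZMod (2 * S + 1))
    (hq : ∀ i, 2 * S + 1 - 3 ≤ (z i + (S : ZMod (2 * S + 1)) - p i).val) (a b : TorusSite 4 (2 * S + 1))
    (Ba Bb : Fin 4 → ZMod (2 * S + 1)) (fa fb : Fin 4 → Bool) (ca cb : Fin 4 → ℤ)
    (k₁a k₂a j₁a j₂a k₁b k₂b j₁b j₂b : Fin 4 → ℕ)
    (hcva : ∀ j, ca j = -2 ∨ ca j = 1) (hcvb : ∀ j, cb j = -2 ∨ cb j = 1)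
    (hcorea : ∀ j, (a j - Ba j).val = 1 ∨ (a j - Ba j).val = 2)
    (hcoreb : ∀ j, (b j - Bb j).val = 1 ∨ (b j - Bb j).val = 2)
    (hfara : ∀ j, fa j = true → (ca j = -2 → (a j - Ba j).val = 2) ∧ (ca j = 1 → (a j - Ba j).val = 1))
    (hfarb : ∀ j, fb j = true → (cb j = -2 → (b j - Bb j).val = 2) ∧ (cb j = 1 → (b j - Bb j).val = 1))
    (hka : ∀ j, Even (k₁a j) ∧ Odd (k₂a j) ∧ k₂a j ≤ 2 * S + 1 - 4 ∧ 2 * S + 1 - 3 ≤ j₁a j)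
    (hkb : ∀ j, Even (k₁b j) ∧ Odd (k₂b j) ∧ k₂b j ≤ 2 * S + 1 - 4 ∧ 2 * S + 1 - 3 ≤ j₁b j)
    (hwina : ∀ j (u : ZMod (2 * S + 1)),
      (((u - Ba j).val ≤ 3 ∧ (fa j = true → ((u - Ba j).val : ℤ) ≠ ca j + 2)) ∧ (u - p j).val ≤ 2 * S + 1 - 4 →
          k₁a j ≤ (u - p j).val ∧ (u - p j).val ≤ k₂a j) ∧
      (k₁a j ≤ (u - p j).val ∧ (u - p j).val ≤ k₂a j →
          (u - Ba j).val ≤ 3 ∧ (fa j = true → ((u - Ba j).val : ℤ) ≠ ca j + 2)) ∧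
      (((u - Ba j).val ≤ 3 ∧ (fa j = true → ((u - Ba j).val : ℤ) ≠ ca j + 2)) ∧ 2 * S + 1 - 3 ≤ (u - p j).val ↔
          j₁a j ≤ (u - p j).val ∧ (u - p j).val ≤ j₂a j))
    (hwinb : ∀ j (u : ZMod (2 * S + 1)),
      (((u - Bb j).val ≤ 3 ∧ (fb j = true → ((u - Bb j).val : ℤ) ≠ cb j + 2)) ∧ (u - p j).val ≤ 2 * S + 1 - 4 →
          k₁b j ≤ (u - p j).val ∧ (u - p j).val ≤ k₂b j) ∧
      (k₁b j ≤ (u - p j).val ∧ (u - p j).val ≤ k₂b j →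
          (u - Bb j).val ≤ 3 ∧ (fb j = true → ((u - Bb j).val : ℤ) ≠ cb j + 2)) ∧
      (((u - Bb j).val ≤ 3 ∧ (fb j = true → ((u - Bb j).val : ℤ) ≠ cb j + 2)) ∧ 2 * S + 1 - 3 ≤ (u - p j).val ↔
          j₁b j ≤ (u - p j).val ∧ (u - p j).val ≤ j₂b j))
    (i₁ i₂ k : Fin 4) (v : ZMod (2 * S + 1))
    (hsa : (∃ j, j₂a j < j₁a j) ∨ ((∀ u : ZMod (2 * S + 1), j₁a i₁ ≤ (u - p i₁).val ∧ (u - p i₁).val ≤ j₂a i₁ →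
        u = z i₁ + (S : ZMod (2 * S + 1))) ∧ i₁ ≠ k ∧
        ∀ u : ZMod (2 * S + 1), (j₁a k ≤ (u - p k).val ∧ (u - p k).val ≤ j₂a k) ↔ (u = v ∨ u = v + 1)))
    (hsb : (∃ j, j₂b j < j₁b j) ∨ ((∀ u : ZMod (2 * S + 1), j₁b i₂ ≤ (u - p i₂).val ∧ (u - p i₂).val ≤ j₂b i₂ →
        u = z i₂ + (S : ZMod (2 * S + 1))) ∧ i₂ ≠ k ∧
        ∀ u : ZMod (2 * S + 1), (j₁b k ≤ (u - p k).val ∧ (u - p k).val ≤ j₂b k) ↔ (u = v ∨ u = v + 1))) :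
    ∃ (x' y' : TorusSite 4 (2 * S + 1)) (Q₁ Q₂ : Finset (Edge 4 (2 * S + 1))),
      a ∈ ebox S x' 0 ∧ b ∈ ebox S y' 0 ∧ IsPadRegion S x' Q₁ ∧ IsPadRegion S y' Q₂ ∧
      Q₁ ⊆ padLinks S x' ∧ Q₂ ⊆ padLinks S y' ∧
      Balanced (touched S (ebox S z (S - 1))ᶜ (starLinks S a ∪ starLinks S b ∪ Q₁ ∪ Q₂)) := by
  haveI : NeZero (2 * S + 1) := ⟨by omega⟩
  have hS2 : 2 ≤ S := by omega
  obtain ⟨hMa, hax, hast, hPa⟩ := tstar_block hS2 p Ba fa ca k₁a k₂a j₁a j₂a a hcva hcorea hfara hwina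
  obtain ⟨hMb, hby, hbst, hPb⟩ := tstar_block hS2 p Bb fb cb k₁b k₂b j₁b j₂b b hcvb hcoreb hfarb hwinb
  set x' : TorusSite 4 (2 * S + 1) := fun j => Ba j + 2 with hx'
  set y' : TorusSite 4 (2 * S + 1) := fun j => Bb j + 2 with hy'
  set M₁ : Finset (Fin 4) := Finset.univ.filter fun j => fa j = true with hM₁
  set M₂ : Finset (Fin 4) := Finset.univ.filter fun j => fb j = true with hM₂
  set P₁ := ebox S x' 1 \ padFrozen S x' M₁ ca with hP₁
  set P₂ := ebox S y' 1 \ padFrozen S y' M₂ cb with hP₂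
  set q : Fin 4 → ZMod (2 * S + 1) := fun j => z j + (S : ZMod (2 * S + 1)) with hqd
  have hE : ∀ w : TorusSite 4 (2 * S + 1), w ∉ ebox S z (S - 1) ↔ ∃ j, w j = q j :=
    fun w => thin_compl_chart (by omega) z w
  -- the engine
  obtain ⟨σ, hσ₁, hσ₂, hσσ, hadj⟩ := rs_engine hS (ebox S z (S - 1)) q p hE hq P₁ P₂
    (fun j u => k₁a j ≤ (u - p j).val ∧ (u - p j).val ≤ k₂a j)
    (fun j u => j₁a j ≤ (u - p j).val ∧ (u - p j).val ≤ j₂a j)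
    (fun j u => k₁b j ≤ (u - p j).val ∧ (u - p j).val ≤ k₂b j)
    (fun j u => j₁b j ≤ (u - p j).val ∧ (u - p j).val ≤ j₂b j)
    hPa hPb (fun j u h => h.2.trans (hka j).2.2.1) (fun j u h => h.2.trans (hkb j).2.2.1)
    (fun j u h => (hka j).2.2.2.trans h.1) (fun j u h => (hkb j).2.2.2.trans h.1)
    (fun j u h => by
      have F := flip_window (p j) (k₁a j) (k₂a j) (hka j).1 (hka j).2.1 (by have := (hka j).2.2.1; omega) u h.1 h.2
      exact ⟨F.1, F.2.1⟩)
    (fun j u h => by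
      have F := flip_window (p j) (k₁b j) (k₂b j) (hkb j).1 (hkb j).2.1 (by have := (hkb j).2.2.1; omega) u h.1 h.2
      exact ⟨F.1, F.2.1⟩)
    i₁ i₂ k v
    (hsa.imp (fun ⟨j, hj⟩ => ⟨j, fun u hu => by omega⟩) id)
    (hsb.imp (fun ⟨j, hj⟩ => ⟨j, fun u hu => by omega⟩) id)
  -- the region
  set Q₁ := (padLinks S x').filter fun e : Edge 4 (2 * S + 1) =>
    e.1 ∉ padFrozen S x' M₁ ca ∧ e.1.shift e.2 ∉ padFrozen S x' M₁ ca with hQ₁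
  set Q₂ := (padLinks S y').filter fun e : Edge 4 (2 * S + 1) =>
    e.1 ∉ padFrozen S y' M₂ cb ∧ e.1.shift e.2 ∉ padFrozen S y' M₂ cb with hQ₂
  have hreg₁ : IsPadRegion S x' Q₁ := by
    have := isPadRegion_forced_union x' M₁ ca hMa ∅ (Finset.empty_subset _)
    rwa [Finset.union_empty] at this
  have hreg₂ : IsPadRegion S y' Q₂ := by
    have := isPadRegion_forced_union y' M₂ cb hMb ∅ (Finset.empty_subset _)
    rwa [Finset.union_empty] at this
  refine ⟨x', y', Q₁, Q₂, hax, hby, hreg₁, hreg₂, Finset.filter_subset _ _, Finset.filter_subset _ _, ?_⟩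
  have hsta := star_subset_forced x' a M₁ ca hast
  have hstb := star_subset_forced y' b M₂ cb hbst
  have hA : ∀ w : TorusSite 4 (2 * S + 1), w ∈ (ebox S z (S - 1))ᶜ ↔ w ∉ ebox S z (S - 1) :=
    fun w => Finset.mem_compl
  intro χ hχ
  refine balanced_touched_of_blocks (ebox S z (S - 1))ᶜ (starLinks S a ∪ starLinks S b ∪ Q₁ ∪ Q₂) P₁ P₂ σ
    ?_ ?_ ?_ ?_ ?_ ?_ ?_ χ hχ
  · intro e he
    simp only [Finset.mem_union] at he
    rcases he with ((h | h) | h) | h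
    · exact Or.inl (hsta e h)
    · exact Or.inr (hstb e h)
    · exact Or.inl ((mem_forced_iff x' M₁ ca e).1 h)
    · exact Or.inr ((mem_forced_iff y' M₂ cb e).1 h)
  · intro w μ hw hw'
    simp only [Finset.mem_union]
    exact Or.inl (Or.inr ((mem_forced_iff x' M₁ ca (w, μ)).2 ⟨hw, hw'⟩))
  · intro w μ hw hw'
    simp only [Finset.mem_union]
    exact Or.inr ((mem_forced_iff y' M₂ cb (w, μ)).2 ⟨hw, hw'⟩)
  · intro w hw hwA
    have h := hσ₁ w hw ((hA w).1 hwA)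
    exact ⟨h.1, (hA _).2 h.2⟩
  · intro w hw hwA
    have h := hσ₂ w hw ((hA w).1 hwA)
    exact ⟨h.1, (hA _).2 h.2⟩
  · exact fun w hw hwA => hσσ w hw ((hA w).1 hwA)
  · exact fun w hw hwA => hadj w hw ((hA w).1 hwA)

/-- **Registered helper `stub_placementSides_aux8` of crux stmt-QuantumFields-17375** (line `pad-the-fibre`, stub
`stub_placementSides`): the thinnest box complement is the union of the four antipodal hyperplanes. [folklore] -/
theorem stub_placementSides_aux8 : ∀ (S : ℕ), 1 ≤ S → ∀ (z y : TorusSite 4 (2 * S + 1)), (y ∉ ebox S z (S - 1) ↔ ∃ j, y j = z j + (S : ZMod (2 * S + 1))) :=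
  fun _ hS z y => thin_compl_chart hS z y

end Summit.QuantumFields.QCD.Theorems.PadTheFibreTwoStar

end
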